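import Literature.MathematicalPhysics.QuantumLattice.InfiniteVolumeLSMStateProofs
import Literature.MathematicalPhysics.QuantumLattice.InfiniteVolumeLSMChainProofs
import Literature.MathematicalPhysics.QuantumLattice.InfiniteVolumeLSMKomaProofs
import HarnessLib

/-!
# Bounded block-charge fluctuations and Koma's inequality for gapped spin chains

Trunk **T-QLATTICE**, family `hubbard`, statement **hubbard.S23**. Proof file (theorems only)
completing the fluctuation route (Tasaki 2018, §3) to the Affleck–Lieb / Lieb–Schultz–Mattis
theorem for the spin-`n/2` Heisenberg chain `heisenbergInteraction n J` in infinite volume, with the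
local ground-state criteria of `InfiniteVolumeStates.lean` (Tasaki 2022, Defs. 2.2, 2.5). The named
facts `no_unique_gapped_groundState_halfOddSpin` / `not_hasUniqueGappedGroundState_halfOddSpin` are
discharged in `InfiniteVolumeLSMProofs.lean` (continuity/IVT route) and
`InfiniteVolumeHalfOddSpinProofs.lean`; the present file records the quantitative estimates of the
alternative route, which are results in their own right and do not assume `n` odd except in Koma's
inequality:

* `lsm_twist_energy_le` — **Lemma 3.1 (variational estimate)** for the local twist `U` on
  `{0,…,ℓ+1}` read in `Λ' = {-1,…,ℓ+2}`: `Re ω(Uᴴ(HU - UH)) ≤ 2π²n²|J|/ℓ` for every ground state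
  (Tasaki 2022, Lemma 3.1; Tasaki 2018, Lemma 1);
* `lsm_blockMag_energy_le`, `lsm_blockMag_variance_le` — **bounded block-charge fluctuations**: for a
  gapped ground state with gap `γ` and zero magnetisation, `γ · ω(M²) ≤ |J|n²/2` for the block
  magnetisation `M = Σ_{z=1}^{ℓ} Sᶻ_z`, uniformly in `ℓ` (gap inequality at `V = M`, invariance
  `ω([H, M²]) = 0`, and the block-magnetisation identity: only the two boundary bonds of the block
  contribute). For integer spin such states exist (Haldane phase), so this is a genuine area law for
  charge fluctuations under the local gap criterion; for half-odd-integer spin it replaces the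
  clustering input of Tasaki 2022, Lemma 3.3;
* `lsm_koma` — **Koma's inequality** (Tasaki 2018, Lemma 2; Tasaki 2022, eq. (3.17)) for odd `n`:
  if `ω(U⁺) = ω(U)` then `4|ω(U⁺)|² ≤ (2π/ℓ)² ω(M²)` (`U = RU⁺`, Cauchy–Schwarz, and the operator
  inequality `2 + R + Rᴴ ≤ (2π/ℓ)²M²` of `InfiniteVolumeLSMKomaProofs.lean`); `lsm_translate` supplies
  `ω(U⁺) = ω(U)` from translation invariance;
* `lsm_gap_le` — the resulting **quantitative gap bound**: a translation-invariant, zero-magnetisation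
  gapped ground state of a half-odd-integer spin chain has gap `γ ≤ (π²|J|n²/2 + 2π²n²|J|)/ℓ` for
  every `ℓ ≥ 1` (hence no such state exists — the Affleck–Lieb theorem once more, via
  `HasUniqueGroundState.expect_shift_heisenberg` / `expect_flipOp_heisenberg`).

## References

* H. Tasaki, *Lieb–Schultz–Mattis theorem with a local twist for general one-dimensional quantum
  systems*, J. Stat. Phys. 170 (2018) 653–671, arXiv:1708.05186 (held), §3: Lemma 1 (variational
  estimate), Lemma 2 (Koma's inequality), Theorem 1, Corollary 1b. [Tasaki2018]
* H. Tasaki, *The Lieb–Schultz–Mattis theorem: a topological point of view*, EMS Press (2022),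
  arXiv:2202.06243 (held), §2.1 Defs. 2.2/2.5, §3.1 Lemmas 3.1–3.2, §3.2 Lemma 3.3, eqs.
  (3.14)–(3.17). [Tasaki2022]
* I. Affleck, E. H. Lieb, Lett. Math. Phys. 12 (1986) 57–69 (not held). [AffleckLiebLMP1986]
-/

noncomputable section

open Matrix Complex Finset
open scoped ComplexOrder Matrix.Norms.L2Operator

namespace Literature.MathematicalPhysics.QuantumLattice

open Literature.Probability.LatticeModels
open Literature.Probability.LatticeModels (Site)

/-! ### Regions, and the twist objects under isotony and translation -/

section Assembly

variable (n : ℕ) (J : ℝ) (ℓ : ℕ)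

/-- Inclusion of interval regions. [folklore] -/
theorem Ival_subset_Ival {a b a' b' : ℤ} (ha : a' ≤ a) (hb : b ≤ b') : Ival a b ⊆ Ival a' b' := by
  intro x hx
  rw [mem_Ival] at hx ⊢
  exact ⟨ha.trans hx.1, hx.2.trans hb⟩

/-- The `1`-neighbourhood of an interval region is contained in the enlarged interval. [folklore] -/
theorem thicken_Ival_one_subset (a b : ℤ) : thicken (Ival a b) 1 ⊆ Ival (a - 1) (b + 1) := by
  intro y hy
  simp only [thicken, Finset.mem_biUnion, Finset.mem_image, Nat.floor_one] at hy
  obtain ⟨x, hx, v, hv, rfl⟩ := hy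
  rw [mem_Ival] at hx ⊢
  rw [mem_box] at hv
  have := hv 0
  simp only [Nat.cast_one, Pi.add_apply] at this ⊢
  omega

/-- Membership in the translate of an interval region. [folklore] -/
theorem mem_map_shift_one_Ival {a b : ℤ} {y : Site 1} :
    y ∈ (Ival a b).map (Site.shift (1 : Site 1)).toEmbedding ↔ a + 1 ≤ y 0 ∧ y 0 ≤ b + 1 := by
  rw [Finset.mem_map]
  constructor
  · rintro ⟨x, hx, rfl⟩
    rw [mem_Ival] at hx
    simp only [Equiv.coe_toEmbedding, Site.shift_apply, Pi.add_apply, Pi.one_apply]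
    omega
  · intro hy
    refine ⟨y - 1, ?_, ?_⟩
    · rw [mem_Ival]; simp only [Pi.sub_apply, Pi.one_apply]; omega
    · simp [Site.shift_apply]

/-- Twists with angle functions differing pointwise by elements of `2πℤ` coincide
(`U_{θ₁} = U_{θ₁-θ₂} U_{θ₂}` and `twistOp_eq_one_of_int`). Tasaki (2022) §3.1 (the identity
`exp[-i2π(Ŝᶻ + S)] = 1`). [cite: Tasaki2022, §3.1 eq. (3.3)] -/
theorem twistOp_congr_of_int {X : Type*} [Fintype X] [DecidableEq X] {q : ℕ} {θ₁ θ₂ : X → ℝ}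
    (h : ∀ x, ∃ m : ℤ, θ₁ x - θ₂ x = 2 * Real.pi * m) : (twistOp θ₁ : Op X q) = twistOp θ₂ := by
  have : θ₁ = (θ₁ - θ₂) + θ₂ := by abel
  rw [this, twistOp_add, twistOp_eq_one_of_int (fun x => ?_), one_mul]
  obtain ⟨m, hm⟩ := h x
  exact ⟨m, by rw [Pi.sub_apply, hm]⟩

/-- The twist angle is in `2πℤ` off `{1, …, ℓ-1}`: `θ_z = 0` for `z ≤ 0`, `θ_z = 2π` for `z ≥ ℓ`.
[cite: Tasaki2022, §3.1 eq. (3.2)] -/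
theorem twistAngle_mem_int (hℓ : ℓ ≠ 0) {z : Site 1} (hz : z 0 ≤ 0 ∨ (ℓ : ℤ) ≤ z 0) :
    ∃ m : ℤ, twistAngle ℓ z = 2 * Real.pi * m := by
  rcases hz with hz | hz
  · exact ⟨0, by rw [twistAngle_of_nonpos ℓ hz]; simp⟩
  · exact ⟨1, by rw [twistAngle_of_le ℓ hℓ hz]; simp⟩

/-- The local twist on `{0,…,ℓ+1}` embedded in `{-1,…,ℓ+2}` is the local twist there. [folklore] -/
theorem embedOp_localTwistOp (hℓ : ℓ ≠ 0) (h : Ival 0 (ℓ + 1) ⊆ Ival (-1) (ℓ + 2)) :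
    embedOp h (localTwistOp n ℓ (Ival 0 (ℓ + 1))) = localTwistOp n ℓ (Ival (-1) (ℓ + 2)) := by
  rw [localTwistOp_def, localTwistOp_def, embedOp_twistOp]
  refine twistOp_congr_of_int fun y => ?_
  by_cases hy : (y : Site 1) ∈ Ival 0 ((ℓ : ℤ) + 1)
  · exact ⟨0, by rw [dif_pos hy]; simp⟩
  · rw [dif_neg hy, zero_sub]
    have hy' := y.2
    rw [mem_Ival] at hy hy'
    obtain ⟨m, hm⟩ := twistAngle_mem_int ℓ hℓ (z := (y : Site 1)) (by omega)
    exact ⟨-m, by rw [hm]; push_cast; ring⟩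

/-- The translated twist on `{0,…,ℓ+1}` embedded in `{-1,…,ℓ+2}`. [folklore] -/
theorem embedOp_localTwistOpShift (hℓ : ℓ ≠ 0) (h : Ival 0 (ℓ + 1) ⊆ Ival (-1) (ℓ + 2)) :
    embedOp h (localTwistOpShift n ℓ (Ival 0 (ℓ + 1))) = localTwistOpShift n ℓ (Ival (-1) (ℓ + 2)) := by
  rw [localTwistOpShift_def, localTwistOpShift_def, embedOp_twistOp]
  refine twistOp_congr_of_int fun y => ?_
  by_cases hy : (y : Site 1) ∈ Ival 0 ((ℓ : ℤ) + 1)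
  · exact ⟨0, by rw [dif_pos hy]; simp⟩
  · rw [dif_neg hy, zero_sub]
    have hy' := y.2
    rw [mem_Ival] at hy hy'
    obtain ⟨m, hm⟩ := twistAngle_mem_int ℓ hℓ (z := (y : Site 1) - 1)
      (by simp only [Pi.sub_apply, Pi.one_apply]; omega)
    exact ⟨-m, by rw [hm]; push_cast; ring⟩

/-- The translated twist on the translated region embedded in `{-1,…,ℓ+2}`. [folklore] -/
theorem embedOp_localTwistOpShift_map (hℓ : ℓ ≠ 0)
    (h : (Ival 0 (ℓ + 1)).map (Site.shift (1 : Site 1)).toEmbedding ⊆ Ival (-1) (ℓ + 2)) :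
    embedOp h (localTwistOpShift n ℓ ((Ival 0 (ℓ + 1)).map (Site.shift (1 : Site 1)).toEmbedding)) =
      localTwistOpShift n ℓ (Ival (-1) (ℓ + 2)) := by
  rw [localTwistOpShift_def, localTwistOpShift_def, embedOp_twistOp]
  refine twistOp_congr_of_int fun y => ?_
  by_cases hy : (y : Site 1) ∈ (Ival 0 ((ℓ : ℤ) + 1)).map (Site.shift (1 : Site 1)).toEmbedding
  · exact ⟨0, by rw [dif_pos hy]; simp⟩
  · rw [dif_neg hy, zero_sub]
    have hy' := y.2
    rw [mem_Ival] at hy'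
    rw [mem_map_shift_one_Ival] at hy
    obtain ⟨m, hm⟩ := twistAngle_mem_int ℓ hℓ (z := (y : Site 1) - 1)
      (by simp only [Pi.sub_apply, Pi.one_apply]; omega)
    exact ⟨-m, by rw [hm]; push_cast; ring⟩

/-- The value of `(finsetMapEquiv (shift v) Λ).symm` is the back-translate. [folklore] -/
theorem coe_finsetMapEquiv_shift_symm {d : ℕ} (v : Site d) (Λ : Finset (Site d))
    (y : ↥(Λ.map (Site.shift v).toEmbedding)) :
    (((finsetMapEquiv (Site.shift v).toEmbedding Λ).symm y : ↥Λ) : Site d) = (y : Site d) - v := by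
  obtain ⟨x, rfl⟩ := (finsetMapEquiv (Site.shift v).toEmbedding Λ).surjective y
  rw [Equiv.symm_apply_apply, coe_finsetMapEquiv_apply]
  simp [Site.shift_apply]

/-- Translating the local twist gives the translated twist on the translated region
(`transportOp_twistOp`). Tasaki (2022) §3.2, eq. (3.15). [cite: Tasaki2022, §3.2 eq. (3.15)] -/
theorem transportOp_localTwistOp (Λ : Finset (Site 1)) :
    transportOp (finsetMapEquiv (Site.shift (1 : Site 1)).toEmbedding Λ) (localTwistOp n ℓ Λ) =
      localTwistOpShift n ℓ (Λ.map (Site.shift (1 : Site 1)).toEmbedding) := by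
  rw [localTwistOp_def, localTwistOpShift_def, transportOp_twistOp]
  congr 1
  funext y
  rw [coe_finsetMapEquiv_shift_symm]

/-- The block magnetisation as a sum of single-site operators of a global family. [folklore] -/
theorem blockMag_eq_sum_onSite (Λ : Finset (Site 1)) :
    blockMag n ℓ Λ = ∑ z : ↥Λ, onSite z (blockWeight ℓ z • SpinOperators.spinZ n) := by
  rw [blockMag_def]
  simp_rw [onSite_smul']

/-- The block magnetisation on `{0,…,ℓ+1}` embedded in `{-1,…,ℓ+2}`. [folklore] -/
theorem embedOp_blockMag (h : Ival 0 (ℓ + 1) ⊆ Ival (-1) (ℓ + 2)) :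
    embedOp h (blockMag n ℓ (Ival 0 (ℓ + 1))) = blockMag n ℓ (Ival (-1) (ℓ + 2)) := by
  rw [blockMag_eq_sum_onSite, blockMag_eq_sum_onSite]
  refine embedOp_sum_onSite h (fun z => blockWeight ℓ z • SpinOperators.spinZ n) fun y hy hy' => ?_
  rw [mem_Ival] at hy hy'
  have : blockWeight ℓ y = 0 := by
    rw [blockWeight, if_neg]; omega
  rw [this, zero_smul]

/-- The block magnetisation is Hermitian. [folklore] -/
theorem blockMag_conjTranspose (Λ : Finset (Site 1)) : (blockMag n ℓ Λ)ᴴ = blockMag n ℓ Λ := by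
  have hz : (SpinOperators.spinZ n)ᴴ = SpinOperators.spinZ n := (spinVec_isHermitian n 2).eq
  rw [blockMag_def, conjTranspose_sum]
  refine Finset.sum_congr rfl fun z _ => ?_
  rw [conjTranspose_smul, ← onSite_conjTranspose, hz]
  congr 1
  rw [blockWeight]; split_ifs <;> simp

variable {n J ℓ}

/-- **Lemma 3.1 (variational estimate) in infinite volume** (Tasaki 2022, Lemma 3.1, eqs. (3.8)–(3.13);
Tasaki 2018, Lemma 1): for a ground state `ω` of the spin-`n/2` Heisenberg chain and the local twist
`U` read in the region `Λ' = {-1,…,ℓ+2}` with local Hamiltonian `H`,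
`Re ω(Uᴴ(HU - UH)) ≤ 2π² n² |J| / ℓ`: `ω(Uᴴ[H,U]) ≤ ω(Uᴴ[H,U]) + ω(U[H,Uᴴ]) = ω(UᴴHU + UHUᴴ - 2H)`
(the ground-state inequality at `Uᴴ`), the twisted chain identity, `|ω(S⁺S⁻' + S⁻S⁺')| ≤ n²`, and
`1 - cos(2π/ℓ) ≤ 2π²/ℓ²` on the `ℓ` twisted bonds. [cite: Tasaki2022, §3.1 Lemma 3.1] -/
theorem lsm_twist_energy_le {ω : InfVolState 1 (n + 1)}
    (hgs : ω.IsGroundState (heisenbergInteraction n J) 1) (hℓ : 1 ≤ ℓ) :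
    (ω.expect (Ival (-1) (ℓ + 2)) ((localTwistOp n ℓ (Ival (-1) (ℓ + 2)))ᴴ *
        (localHamiltonian ((heisenbergInteraction n J).restrict (Ival (-1) (ℓ + 2))) univ *
            localTwistOp n ℓ (Ival (-1) (ℓ + 2)) -
          localTwistOp n ℓ (Ival (-1) (ℓ + 2)) *
            localHamiltonian ((heisenbergInteraction n J).restrict (Ival (-1) (ℓ + 2))) univ))).re ≤
      2 * Real.pi ^ 2 * (n : ℝ) ^ 2 * |J| / ℓ := by
  have hℓ0 : ℓ ≠ 0 := by omega
  set Λ := Ival 0 ((ℓ : ℤ) + 1) with hΛ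
  set Λ' := Ival (-1) ((ℓ : ℤ) + 2) with hΛ'
  have h : Λ ⊆ Λ' := Ival_subset_Ival (by norm_num) (by omega)
  have hT : thicken Λ 1 ⊆ Λ' := (thicken_Ival_one_subset 0 _).trans (Ival_subset_Ival le_rfl (by omega))
  set U := localTwistOp n ℓ Λ' with hU
  set H := localHamiltonian ((heisenbergInteraction n J).restrict Λ') univ with hH
  have hR := hasFiniteRange_heisenbergInteraction n J
  -- the ground-state inequality for `Uᴴ`
  have hgs' : 0 ≤ ω.expect Λ' (U * (H * Uᴴ - Uᴴ * H)) := by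
    have := hgs.expect_comm_nonneg hR Λ (localTwistOp n ℓ Λ)ᴴ hT
    rwa [embedOp_conjTranspose, embedOp_localTwistOp n ℓ hℓ0 h, conjTranspose_conjTranspose] at this
  -- the twisted chain identity
  have hUU : Uᴴ * U = 1 := twistOp_conjTranspose_mul_self _
  have hUU' : U * Uᴴ = 1 := twistOp_mul_conjTranspose_self _
  have hsum : Uᴴ * (H * U - U * H) + U * (H * Uᴴ - Uᴴ * H) =
      Uᴴ * H * U + U * H * Uᴴ - (2 : ℂ) • H := by
    rw [mul_sub, mul_sub, ← mul_assoc, ← mul_assoc, ← mul_assoc, ← mul_assoc, hUU, hUU', one_mul,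
      two_smul]
    abel
  have htwist := twist_conj_chainHamiltonian n J Λ' (fun z : ↥Λ' => twistAngle ℓ z)
  rw [← localTwistOp_def, ← hU, ← hH] at htwist
  -- real parts
  have key : (ω.expect Λ' (Uᴴ * (H * U - U * H))).re ≤
      (ω.expect Λ' (Uᴴ * H * U + U * H * Uᴴ - (2 : ℂ) • H)).re := by
    rw [← hsum, map_add, Complex.add_re]
    have := (Complex.nonneg_iff.1 hgs').1
    linarith
  refine key.trans ((Complex.re_le_norm _).trans ?_)
  rw [htwist]
  refine (ω.norm_expect_bondSum_le n Λ' J _).trans ?_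
  -- termwise bound and counting
  have hterm : ∀ x y : ↥Λ', (y : Site 1) = (x : Site 1) + 1 →
      ‖(((Real.cos (twistAngle ℓ y - twistAngle ℓ x) - 1 : ℝ) : ℂ))‖ * (n : ℝ) ^ 2 ≤
        if (x : Site 1) 0 ∈ Finset.Icc (0 : ℤ) (ℓ - 1) then (2 * Real.pi / ℓ) ^ 2 / 2 * (n : ℝ) ^ 2
          else 0 := by
    intro x y hxy
    rw [hxy, Complex.norm_real, Real.norm_eq_abs, abs_sub_comm, abs_of_nonneg (by
      linarith [Real.cos_le_one (twistAngle ℓ ((x : Site 1) + 1) - twistAngle ℓ x)]),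
      twistAngle_add_one_sub]
    by_cases hx : 0 ≤ (x : Site 1) 0 ∧ (x : Site 1) 0 ≤ (ℓ : ℤ) - 1
    · rw [if_pos hx, if_pos (Finset.mem_Icc.2 hx)]
      have := Real.one_sub_sq_div_two_le_cos (x := 2 * Real.pi / ℓ)
      nlinarith [sq_nonneg (n : ℝ)]
    · rw [if_neg hx, if_neg (fun h => hx (Finset.mem_Icc.1 h))]
      simp
  refine (mul_le_mul_of_nonneg_left (sum_sum_ite_le_sum Λ' _ _ hterm fun x => by positivity)
    (abs_nonneg J)).trans ?_
  refine (mul_le_mul_of_nonneg_left (sum_ite_coord_mem_le Λ' _ _ (by positivity))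
    (abs_nonneg J)).trans (le_of_eq ?_)
  rw [Int.card_Icc, show ((ℓ : ℤ) - 1 + 1 - 0).toNat = ℓ by omega]
  have : (ℓ : ℝ) ≠ 0 := by exact_mod_cast hℓ0
  field_simp

/-- **The block-magnetisation estimate**: for a ground state `ω` of the chain and the block
magnetisation `M` on `Λ' = {-1,…,ℓ+2}` with local Hamiltonian `H`, `Re ω(Mᴴ(HM - MH)) ≤ |J| n² / 2`.
Indeed `2 ω(M[H,M]) = ω([M,[H,M]])` because `ω([H, M²]) = 0` (invariance of ground states;
`M ⊗ 𝟙` from `{0,…,ℓ+1}`), and `[M,[H,M]] = -J Σ ((w_x-w_{x+1})²/2)(S⁺S⁻' + S⁻S⁺')` has only the two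
boundary bonds of the block, each bounded by `n²/2` in the state (the infinitesimal form of the
variational estimate for the *uniform* block rotation `e^{iφM}`, Tasaki 2022 Lemma 3.1).
[cite: Tasaki2022, §3.1 Lemma 3.1] -/
theorem lsm_blockMag_energy_le {ω : InfVolState 1 (n + 1)}
    (hgs : ω.IsGroundState (heisenbergInteraction n J) 1) :
    (ω.expect (Ival (-1) (ℓ + 2)) ((blockMag n ℓ (Ival (-1) (ℓ + 2)))ᴴ *
        (localHamiltonian ((heisenbergInteraction n J).restrict (Ival (-1) (ℓ + 2))) univ *
            blockMag n ℓ (Ival (-1) (ℓ + 2)) -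
          blockMag n ℓ (Ival (-1) (ℓ + 2)) *
            localHamiltonian ((heisenbergInteraction n J).restrict (Ival (-1) (ℓ + 2))) univ))).re ≤
      |J| * (n : ℝ) ^ 2 / 2 := by
  set Λ := Ival 0 ((ℓ : ℤ) + 1) with hΛ
  set Λ' := Ival (-1) ((ℓ : ℤ) + 2) with hΛ'
  have h : Λ ⊆ Λ' := Ival_subset_Ival (by norm_num) (by omega)
  have hT : thicken Λ 1 ⊆ Λ' := (thicken_Ival_one_subset 0 _).trans (Ival_subset_Ival le_rfl (by omega))
  set M := blockMag n ℓ Λ' with hM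
  set H := localHamiltonian ((heisenbergInteraction n J).restrict Λ') univ with hH
  have hR := hasFiniteRange_heisenbergInteraction n J
  have hMe : embedOp ((subset_thicken Λ 1).trans hT) (blockMag n ℓ Λ) = M := embedOp_blockMag n ℓ h
  -- `ω([H, M²]) = 0`
  have hc : ω.expect Λ' (H * (M * M) - (M * M) * H) = 0 := by
    have := hgs.expect_commutator_eq_zero hR Λ (blockMag n ℓ Λ * blockMag n ℓ Λ) hT
    rwa [embedOp_mul, hMe] at this
  -- `2 ω(M[H,M]) = ω([M, [H, M]])`
  have hdc := weightedMag_double_comm_chainHamiltonian n J Λ' (blockWeight ℓ) M H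
    (blockMag_def n ℓ Λ') hH
  have e1 : M * (H * M - M * H) + (H * M - M * H) * M = H * (M * M) - (M * M) * H := by
    simp only [mul_sub, sub_mul, mul_assoc]
    abel
  have h2 : ((2 : ℝ) : ℂ) * ω.expect Λ' (Mᴴ * (H * M - M * H)) =
      ω.expect Λ' (M * (H * M - M * H) - (H * M - M * H) * M) := by
    rw [blockMag_conjTranspose, map_sub, Complex.ofReal_ofNat, two_mul]
    have := congrArg (ω.expect Λ') e1
    rw [map_add, hc] at this
    linear_combination this
  -- bound the double commutator
  have hbound : ‖ω.expect Λ' (M * (H * M - M * H) - (H * M - M * H) * M)‖ ≤ |J| * (n : ℝ) ^ 2 := by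
    rw [hdc]
    refine (ω.norm_expect_bondSum_le n Λ' J _).trans ?_
    have hterm : ∀ x y : ↥Λ', (y : Site 1) = (x : Site 1) + 1 →
        ‖(-((blockWeight ℓ x - blockWeight ℓ y) ^ 2 / 2))‖ * (n : ℝ) ^ 2 ≤
          if (x : Site 1) 0 ∈ ({0, (ℓ : ℤ)} : Finset ℤ) then (n : ℝ) ^ 2 / 2 else 0 := by
      intro x y hxy
      have hy0 : (y : Site 1) 0 = (x : Site 1) 0 + 1 := by rw [hxy]; rfl
      simp only [blockWeight, hy0, Finset.mem_insert, Finset.mem_singleton]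
      by_cases h1 : 1 ≤ (x : Site 1) 0 ∧ (x : Site 1) 0 ≤ ℓ <;>
        by_cases h2 : 1 ≤ (x : Site 1) 0 + 1 ∧ (x : Site 1) 0 + 1 ≤ ℓ
      · rw [if_pos h1, if_pos h2]; norm_num; split_ifs <;> positivity
      · rw [if_pos h1, if_neg h2, if_pos (by omega)]; norm_num; nlinarith [sq_nonneg (n : ℝ)]
      · rw [if_neg h1, if_pos h2, if_pos (by omega)]; norm_num; nlinarith [sq_nonneg (n : ℝ)]
      · rw [if_neg h1, if_neg h2]; norm_num; split_ifs <;> positivity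
    refine (mul_le_mul_of_nonneg_left (sum_sum_ite_le_sum Λ' _ _ hterm fun x => by positivity)
      (abs_nonneg J)).trans ?_
    refine (mul_le_mul_of_nonneg_left (sum_ite_coord_mem_le Λ' _ _ (by positivity))
      (abs_nonneg J)).trans ?_
    have hcard : (({0, (ℓ : ℤ)} : Finset ℤ).card : ℝ) ≤ 2 := by exact_mod_cast Finset.card_le_two
    have : |J| * ((n : ℝ) ^ 2 / 2 * (({0, (ℓ : ℤ)} : Finset ℤ).card : ℝ)) ≤ |J| * ((n : ℝ) ^ 2 / 2 * 2) :=
      mul_le_mul_of_nonneg_left (mul_le_mul_of_nonneg_left hcard (by positivity)) (abs_nonneg J)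
    linarith
  have hre : (((2 : ℝ) : ℂ) * ω.expect Λ' (Mᴴ * (H * M - M * H))).re ≤ |J| * (n : ℝ) ^ 2 := by
    rw [h2]; exact (Complex.re_le_norm _).trans hbound
  rw [Complex.re_ofReal_mul] at hre
  linarith

/-- **Bounded block-charge fluctuations of a gapped ground state**: if `ω` is a gapped ground state
with gap `γ` and zero magnetisation `ω(Sᶻ_z) = 0`, then `γ · ω(M²) ≤ |J| n²/2` for the block
magnetisation `M = Σ_{z=1}^{ℓ} Sᶻ_z` on `{0,…,ℓ+1}`, uniformly in `ℓ` (the gap inequality of Def. 2.5 at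
`V = M`, where `ω(M) = 0`, and `lsm_blockMag_energy_le`). This replaces the clustering input of
Tasaki 2022, Lemma 3.3 ("`ω((ν̂_ℓ - ν_ω)²)` … should vanish as `ℓ` grows"). [cite: Tasaki2022, §2.1 Def. 2.5] -/
theorem lsm_blockMag_variance_le {ω : InfVolState 1 (n + 1)} {γ : ℝ}
    (hgap : ω.IsGappedGroundState (heisenbergInteraction n J) 1 γ)
    (hZ : ∀ (Λ : Finset (Site 1)) (z : ↥Λ), ω.expect Λ (onSite z (SpinOperators.spinZ n)) = 0) :
    γ * (ω.expect (Ival 0 (ℓ + 1))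
        ((blockMag n ℓ (Ival 0 (ℓ + 1)))ᴴ * blockMag n ℓ (Ival 0 (ℓ + 1)))).re ≤
      |J| * (n : ℝ) ^ 2 / 2 := by
  have h : Ival 0 ((ℓ : ℤ) + 1) ⊆ Ival (-1) ((ℓ : ℤ) + 2) := Ival_subset_Ival (by norm_num) (by omega)
  have hT : thicken (Ival 0 ((ℓ : ℤ) + 1)) 1 ⊆ Ival (-1) ((ℓ : ℤ) + 2) :=
    (thicken_Ival_one_subset 0 _).trans (Ival_subset_Ival le_rfl (by omega))
  have hR := hasFiniteRange_heisenbergInteraction n J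
  have hg := hgap.gap_le_expect_comm hR (Ival 0 ((ℓ : ℤ) + 1)) (blockMag n ℓ (Ival 0 ((ℓ : ℤ) + 1))) hT
  rw [embedOp_blockMag n ℓ h] at hg
  have hM0 : ω.expect (Ival 0 ((ℓ : ℤ) + 1)) (blockMag n ℓ (Ival 0 ((ℓ : ℤ) + 1))) = 0 := by
    rw [blockMag_def, map_sum]
    refine Finset.sum_eq_zero fun z _ => ?_
    rw [map_smul, hZ, smul_zero]
  rw [hM0, norm_zero, zero_pow two_ne_zero, sub_zero] at hg
  have := (Complex.le_def.1 hg).1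
  rw [Complex.ofReal_re] at this
  exact this.trans (lsm_blockMag_energy_le (ℓ := ℓ) hgap.1)

/-- **Koma's inequality** (Tasaki 2018, Lemma 2; Tasaki 2022, proof of Lemma 3.3, eq. (3.17)): for
odd `n` (half-odd-integer spin, filling `ν = S`), if `ω(U⁺) = ω(U)` (translation invariance) then,
since `U = R U⁺` and hence `2ω(U⁺) = ω((R + 1)U⁺)`, the Schwarz inequality and the operator
inequality `(R+1)(R+1)ᴴ = 2 + R + Rᴴ ≤ (2π/ℓ)² M²` give `4|ω(U⁺)|² ≤ (2π/ℓ)² ω(M²)`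
(`|ω(Û_ℓ)| ≤ π √(ω((Δρ̂_ℓ)²)) / |sin πν|` with `sin πν = ±1`). [cite: Tasaki2018, §3 Lemma 2] -/
theorem lsm_koma {ω : InfVolState 1 (n + 1)} (hn : Odd n) (hℓ : 1 ≤ ℓ)
    (hRU : ω.expect (Ival 0 (ℓ + 1)) (localTwistOpShift n ℓ (Ival 0 (ℓ + 1))) =
      ω.expect (Ival 0 (ℓ + 1)) (localTwistOp n ℓ (Ival 0 (ℓ + 1)))) :
    4 * ‖ω.expect (Ival 0 (ℓ + 1)) (localTwistOpShift n ℓ (Ival 0 (ℓ + 1)))‖ ^ 2 ≤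
      (2 * Real.pi / ℓ) ^ 2 *
        (ω.expect (Ival 0 (ℓ + 1)) (blockMag n ℓ (Ival 0 (ℓ + 1)) * blockMag n ℓ (Ival 0 (ℓ + 1)))).re := by
  set Λ := Ival 0 ((ℓ : ℤ) + 1) with hΛ
  set Up := localTwistOpShift n ℓ Λ with hUp
  set R := blockRot n ℓ Λ with hR
  set M := blockMag n ℓ Λ with hM
  have hℓ0 : ℓ ≠ 0 := by omega
  have hI : ∀ z : Site 1, 1 ≤ z 0 → z 0 ≤ ℓ → z ∈ Λ := fun z h1 h2 => by
    rw [hΛ, mem_Ival]; omega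
  -- `2 ω(U⁺) = ω((R + 1) U⁺)`
  have h2 : (2 : ℂ) * ω.expect Λ Up = ω.expect Λ ((R + 1) * Up) := by
    rw [add_mul, one_mul, map_add, ← localTwistOp_eq_blockRot_mul_localTwistOpShift, ← hRU, two_mul]
  -- Schwarz
  have hcs := ω.norm_sq_expect_mul_le Λ (R + 1) Up
  have hUU : Upᴴ * Up = 1 := twistOp_conjTranspose_mul_self _
  rw [hUU, ω.expect_one, Complex.one_re, mul_one] at hcs
  -- `(R+1)(R+1)ᴴ = 2 + R + Rᴴ ≤ (2π/ℓ)² M²`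
  have hXX : (R + 1) * (R + 1)ᴴ = (2 : ℂ) • 1 + R + Rᴴ := by
    rw [conjTranspose_add, conjTranspose_one, add_mul, mul_add, mul_add, one_mul, one_mul, mul_one,
      hR, blockRot_def, twistOp_mul_conjTranspose_self, two_smul]
    abel
  have hpsd := ω.expect_nonneg_of_nonneg Λ
    (Matrix.nonneg_iff_posSemidef.mpr (posSemidef_blockMag_sq_sub hn hℓ0 Λ hI))
  rw [← hM, ← hR, map_sub, map_smul, smul_eq_mul, ← hXX] at hpsd
  have hre := (Complex.nonneg_iff.1 hpsd).1
  rw [Complex.sub_re, Complex.re_ofReal_mul] at hre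
  -- combine
  have h4 : 4 * ‖ω.expect Λ Up‖ ^ 2 = ‖(2 : ℂ) * ω.expect Λ Up‖ ^ 2 := by
    rw [norm_mul, Complex.norm_two]; ring
  rw [h4, h2]
  linarith

/-- **Translation step**: for a translation-invariant state, `ω(U⁺) = ω(U)` for the local twist on
`{0,…,ℓ+1}` (both read in the common region `{-1,…,ℓ+2}`, where the embedded operators agree).
Tasaki (2022) §3.2, eq. (3.14) (`ω(Û_{0,ℓ}) = ω(Û_{p,ℓ})`). [cite: Tasaki2022, §3.2 eq. (3.14)] -/
theorem lsm_translate {ω : InfVolState 1 (n + 1)} (hℓ : 1 ≤ ℓ)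
    (hT : ∀ (Λ : Finset (Site 1)) (A : Op ↥Λ (n + 1)),
      ω.expect (Λ.map (Site.shift (1 : Site 1)).toEmbedding)
        (transportOp (finsetMapEquiv (Site.shift (1 : Site 1)).toEmbedding Λ) A) = ω.expect Λ A) :
    ω.expect (Ival 0 (ℓ + 1)) (localTwistOpShift n ℓ (Ival 0 (ℓ + 1))) =
      ω.expect (Ival 0 (ℓ + 1)) (localTwistOp n ℓ (Ival 0 (ℓ + 1))) := by
  have hℓ0 : ℓ ≠ 0 := by omega
  set Λ := Ival 0 ((ℓ : ℤ) + 1) with hΛ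
  set Λ' := Ival (-1) ((ℓ : ℤ) + 2) with hΛ'
  have h : Λ ⊆ Λ' := Ival_subset_Ival (by norm_num) (by omega)
  have h₂ : Λ.map (Site.shift (1 : Site 1)).toEmbedding ⊆ Λ' := by
    intro y hy
    rw [hΛ, mem_map_shift_one_Ival] at hy
    rw [hΛ', mem_Ival]
    omega
  have h1 := hT Λ (localTwistOp n ℓ Λ)
  rw [transportOp_localTwistOp, ← ω.compatible h₂, embedOp_localTwistOpShift_map n ℓ hℓ0 h₂] at h1
  rw [← h1, ← ω.compatible h, embedOp_localTwistOpShift n ℓ hℓ0 h]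

/-- **The main estimate** (Affleck–Lieb 1986; Tasaki 2022, §3: Lemmas 3.1–3.3 combined): if `ω` is a
gapped ground state (gap `γ`) of the spin-`n/2` Heisenberg chain with `n` odd, which is translation
invariant and has zero magnetisation, then `γ ≤ C/ℓ` for every `ℓ ≥ 1`, with
`C = π²|J|n²/2 + 2π²n²|J|`: the gap inequality at `V = U` gives `γ(1 - |ω(U)|²) ≤ 2π²n²|J|/ℓ`
(Tasaki 2022, Lemma 3.2), while Koma's inequality and the bounded block-charge fluctuations give
`γ|ω(U)|² ≤ (π²/ℓ²)|J|n²/2`. [cite: Tasaki2022, §3.1 Lemma 3.2] -/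
theorem lsm_gap_le {ω : InfVolState 1 (n + 1)} {γ : ℝ} (hn : Odd n)
    (hgap : ω.IsGappedGroundState (heisenbergInteraction n J) 1 γ)
    (hT : ∀ (Λ : Finset (Site 1)) (A : Op ↥Λ (n + 1)),
      ω.expect (Λ.map (Site.shift (1 : Site 1)).toEmbedding)
        (transportOp (finsetMapEquiv (Site.shift (1 : Site 1)).toEmbedding Λ) A) = ω.expect Λ A)
    (hZ : ∀ (Λ : Finset (Site 1)) (z : ↥Λ), ω.expect Λ (onSite z (SpinOperators.spinZ n)) = 0)
    (hℓ : 1 ≤ ℓ) :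
    γ ≤ (Real.pi ^ 2 * |J| * (n : ℝ) ^ 2 / 2 + 2 * Real.pi ^ 2 * (n : ℝ) ^ 2 * |J|) / ℓ := by
  have hℓ0 : ℓ ≠ 0 := by omega
  set Λ := Ival 0 ((ℓ : ℤ) + 1) with hΛ
  set Λ' := Ival (-1) ((ℓ : ℤ) + 2) with hΛ'
  have h : Λ ⊆ Λ' := Ival_subset_Ival (by norm_num) (by omega)
  have hTh : thicken Λ 1 ⊆ Λ' := (thicken_Ival_one_subset 0 _).trans (Ival_subset_Ival le_rfl (by omega))
  have hR := hasFiniteRange_heisenbergInteraction n J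
  have hγ := hgap.2.1
  set u := ω.expect Λ (localTwistOp n ℓ Λ) with hu
  set v := (ω.expect Λ (blockMag n ℓ Λ * blockMag n ℓ Λ)).re with hv
  -- (a) the gap inequality at `U`
  have ha : γ * (1 - ‖u‖ ^ 2) ≤ 2 * Real.pi ^ 2 * (n : ℝ) ^ 2 * |J| / ℓ := by
    have hg := hgap.gap_le_expect_comm hR Λ (localTwistOp n ℓ Λ) hTh
    rw [embedOp_localTwistOp n ℓ hℓ0 h, localTwistOp_def n ℓ Λ, twistOp_conjTranspose_mul_self,
      ω.expect_one, Complex.one_re, ← localTwistOp_def] at hg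
    have := (Complex.le_def.1 hg).1
    rw [Complex.ofReal_re] at this
    exact this.trans (lsm_twist_energy_le hgap.1 hℓ)
  -- (b) Koma + translation
  have hb : 4 * ‖u‖ ^ 2 ≤ (2 * Real.pi / ℓ) ^ 2 * v := by
    have htr := lsm_translate (n := n) (ℓ := ℓ) hℓ hT
    have := lsm_koma hn hℓ htr
    rwa [htr] at this
  -- (c) bounded fluctuations
  have hc : γ * v ≤ |J| * (n : ℝ) ^ 2 / 2 := by
    have := lsm_blockMag_variance_le (ℓ := ℓ) hgap hZ
    rwa [blockMag_conjTranspose] at this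
  -- combine
  have hℓr : (1 : ℝ) ≤ ℓ := by exact_mod_cast hℓ
  have hℓpos : (0 : ℝ) < ℓ := by linarith
  have hb' : γ * ‖u‖ ^ 2 ≤ Real.pi ^ 2 * |J| * (n : ℝ) ^ 2 / 2 / ℓ ^ 2 := by
    have h1 : γ * ‖u‖ ^ 2 ≤ γ * ((2 * Real.pi / ℓ) ^ 2 * v / 4) :=
      mul_le_mul_of_nonneg_left (by linarith) hγ.le
    have h2 : γ * ((2 * Real.pi / ℓ) ^ 2 * v / 4) = (Real.pi ^ 2 / ℓ ^ 2) * (γ * v) := by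
      field_simp; ring
    have h3 : (Real.pi ^ 2 / ℓ ^ 2) * (γ * v) ≤ (Real.pi ^ 2 / ℓ ^ 2) * (|J| * (n : ℝ) ^ 2 / 2) :=
      mul_le_mul_of_nonneg_left hc (by positivity)
    calc γ * ‖u‖ ^ 2 ≤ (Real.pi ^ 2 / ℓ ^ 2) * (|J| * (n : ℝ) ^ 2 / 2) := by linarith
      _ = Real.pi ^ 2 * |J| * (n : ℝ) ^ 2 / 2 / ℓ ^ 2 := by field_simp
  have hsq : Real.pi ^ 2 * |J| * (n : ℝ) ^ 2 / 2 / ℓ ^ 2 ≤ Real.pi ^ 2 * |J| * (n : ℝ) ^ 2 / 2 / ℓ := by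
    apply div_le_div_of_nonneg_left (by positivity) hℓpos
    nlinarith
  have : γ = γ * ‖u‖ ^ 2 + γ * (1 - ‖u‖ ^ 2) := by ring
  rw [this, add_div]
  linarith

end Assembly

end Literature.MathematicalPhysics.QuantumLattice
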